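import Summits.CriticalPhenomena.CardyFormulaZ2.Theorems.CardyQContinuationFirstJetAtOneBounded

/-!
# The first `s`-jet of the self-dual crossing ratio at a general point `t` is a covariance
# (route CardyQContinuation; `n = 1` face of stub `stub_higherJetLimitsExist` of crux stmt-CriticalPhenomena-5560,
# = crux `FirstJetConverges` stmt-CriticalPhenomena-5561 at `t = √2`)

`Theorems/CardyQContinuationFirstJetAtOneBounded.lean` proves the exponential-family identity
`P′_δ(1) = Cov_{unif}(1_C, L)`, `L = |ω| + 2k_B`, at the percolation point `s = 1`. This file proves
it at every complex `t ≠ 0` with `Z_δ(t) ≠ 0` — in particular at the FK-Ising point `t = √2`, where it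
is Grimmett's cumulant formula (The Random-Cluster Model, 2006, Thm 3.12 / eq. (3.75)) for the first
jet: `P′_δ(t) = (1/t) · Cov_t(1_C, L)`, the covariance being under the weights `t^{L(ω)} / Z_δ(t)`,
i.e. (for real `t > 0`) under the critical random-cluster measure with `q = t²`, `p = t/(1+t)` and the
arcs `(ab)_δ ∪ (cd)_δ` jointly wired (cf. `crossingRatio_ofReal_eq_measureReal`, p144240).

* `hasDerivAt_ratio` — quotient rule for `(Σ_F 𝟙_C t^m) / (Σ_F t^m)` at `t ≠ 0`;
* `deriv_crossingRatio` — the route's inline `P_δ` at `δ > 0`: `P′_δ(t) = (Σ 𝟙_C L t^L · Z − N · Σ L t^L) / (t Z²)`;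
* `deriv_crossingRatio_sqrt_two` — the case `t = √2` (no side condition: `Z_δ(√2) > 0`,
  `finsum_weight_sqrt_two_ne_zero`).
-/

namespace Summit.CriticalPhenomena.CardyFormulaZ2.Theorems.CardyQContinuation

open Filter Metric Set Finset
open scoped Topology
open Literature.Probability.LatticeModels Literature.Probability.Percolation
open Literature.Probability.RandomPlanarGeometry

noncomputable section

/-- At `t` the monomial `s ↦ s ^ m` has derivative `m t^(m-1) = (m t^m)/t` when `t ≠ 0`. [folklore] -/
theorem hasDerivAt_pow_div {t : ℂ} (ht : t ≠ 0) (m : ℕ) :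
    HasDerivAt (fun s : ℂ => s ^ m) ((m : ℂ) * t ^ m / t) t := by
  refine (hasDerivAt_pow m t).congr_deriv ?_
  rcases Nat.eq_zero_or_pos m with rfl | hm
  · simp
  · obtain ⟨k, rfl⟩ := Nat.exists_eq_add_of_le hm
    have hk : 1 + k - 1 = k := by omega
    rw [hk, eq_div_iff ht, mul_assoc, ← pow_succ, Nat.succ_eq_add_one, Nat.add_comm 1 k]

/-- At `t ≠ 0` the restricted monomial `s ↦ 𝟙_C(a) · s ^ (m a)` has derivative
`𝟙_C(a) · (m a) t^(m a) / t`. [folklore] -/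
theorem hasDerivAt_indicator_pow_div {α : Type*} (C : Set α) (m : α → ℕ) (a : α) {t : ℂ}
    (ht : t ≠ 0) :
    HasDerivAt (fun s : ℂ => C.indicator (fun b => s ^ m b) a)
      (C.indicator (fun b => (m b : ℂ) * t ^ m b / t) a) t := by
  by_cases ha : a ∈ C
  · simp only [Set.indicator_of_mem ha]
    exact hasDerivAt_pow_div ht (m a)
  · simp only [Set.indicator_of_notMem ha]
    exact hasDerivAt_const t 0

/-- **Quotient rule at a general point for a ratio of restricted monomial sums** (exponential family
in `log s`). For a finite index set `F`, exponents `m : α → ℕ`, an event `C` and `t ≠ 0` with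
`Z(t) = Σ_F t^{m a} ≠ 0`:
`d/ds|_{s=t} (Σ_F 𝟙_C s^{m}) / (Σ_F s^{m}) = ((Σ_F 𝟙_C m t^m) · Z(t) − (Σ_F 𝟙_C t^m) · (Σ_F m t^m)) / (t · Z(t)²)`,
i.e. `(1/t) · (E_t[𝟙_C m] − E_t[𝟙_C] E_t[m])` for the weights `t^{m a}/Z(t)` (Grimmett 2006,
Thm 3.12, eq. (3.75), first order). [cite: Grimmett2006, Thm 3.12] -/
theorem hasDerivAt_ratio {α : Type*} (F : Finset α) (C : Set α) (m : α → ℕ) {t : ℂ} (ht : t ≠ 0)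
    (hZ : (∑ a ∈ F, t ^ m a) ≠ 0) :
    HasDerivAt (fun s : ℂ => (∑ a ∈ F, C.indicator (fun b => s ^ m b) a) / (∑ a ∈ F, s ^ m a))
      (((∑ a ∈ F, C.indicator (fun b => (m b : ℂ) * t ^ m b) a) * (∑ a ∈ F, t ^ m a)
        - (∑ a ∈ F, C.indicator (fun b => t ^ m b) a) * (∑ a ∈ F, (m a : ℂ) * t ^ m a))
        / (t * (∑ a ∈ F, t ^ m a) ^ 2))
      t := by
  have hN : HasDerivAt (fun s : ℂ => ∑ a ∈ F, C.indicator (fun b => s ^ m b) a)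
      (∑ a ∈ F, C.indicator (fun b => (m b : ℂ) * t ^ m b / t) a) t :=
    HasDerivAt.fun_sum fun a _ => hasDerivAt_indicator_pow_div C m a ht
  have hZ' : HasDerivAt (fun s : ℂ => ∑ a ∈ F, s ^ m a) (∑ a ∈ F, (m a : ℂ) * t ^ m a / t) t :=
    HasDerivAt.fun_sum fun a _ => hasDerivAt_pow_div ht (m a)
  have key := hN.fun_div hZ' hZ
  refine key.congr_deriv ?_
  have h1 : (∑ a ∈ F, C.indicator (fun b => (m b : ℂ) * t ^ m b / t) a)
      = (∑ a ∈ F, C.indicator (fun b => (m b : ℂ) * t ^ m b) a) / t := by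
    rw [Finset.sum_div]
    refine Finset.sum_congr rfl fun a _ => ?_
    by_cases ha : a ∈ C
    · simp only [Set.indicator_of_mem ha]
    · simp only [Set.indicator_of_notMem ha, zero_div]
  have h2 : (∑ a ∈ F, (m a : ℂ) * t ^ m a / t) = (∑ a ∈ F, (m a : ℂ) * t ^ m a) / t := by
    rw [Finset.sum_div]
  rw [h1, h2]
  field_simp

/-- **`P′_δ(t)` is a covariance** (the `n = 1` face of the higher-jet items of route CardyQContinuation).
For a conformal rectangle `R`, `δ > 0` and complex `t ≠ 0` at which the self-dual arc partition function
`Z_δ(t) = Σ_{ω ⊆ E(Ω_δ)} t^{L(ω)}`, `L = |ω| + 2k_B`, does not vanish, the first `s`-derivative at `t`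
of the crossing ratio `P_δ = N_δ/Z_δ` (jointly wired arcs) is
`(Σ_ω 𝟙_C L t^L · Z_δ(t) − N_δ(t) · Σ_ω L t^L) / (t Z_δ(t)²) = (1/t) Cov_t(1_C, L)`, the covariance
under the weights `t^L/Z_δ(t)` (for real `t > 0`: the random-cluster measure with `q = t²` at its
self-dual point, arcs wired). [cite: Grimmett2006, Thm 3.12] -/
theorem deriv_crossingRatio (R : ConformalRectangle) {δ : ℝ} (hδ : 0 < δ) {t : ℂ} (ht : t ≠ 0)
    (hZ : (∑ᶠ ω ∈ 𝒫 (discreteDomainGraph R.carrier δ).edgeSet,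
        t ^ (ω.ncard + 2 * Nat.card ((openGraph ω ⊔ wired
            (discreteArc R.carrier δ (R.arc 0) ∪ discreteArc R.carrier δ (R.arc 2))).induce
            (meshDomain R.carrier δ)).ConnectedComponent)) ≠ 0) :
    deriv (fun s : ℂ =>
      (∑ᶠ ω ∈ 𝒫 (discreteDomainGraph R.carrier δ).edgeSet,
        (discreteCrossing R.carrier δ (R.arc 0) (R.arc 2)).indicator
          (fun ω => s ^ (ω.ncard + 2 * Nat.card ((openGraph ω ⊔ wired
            (discreteArc R.carrier δ (R.arc 0) ∪ discreteArc R.carrier δ (R.arc 2))).induce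
            (meshDomain R.carrier δ)).ConnectedComponent)) ω) /
      (∑ᶠ ω ∈ 𝒫 (discreteDomainGraph R.carrier δ).edgeSet,
        s ^ (ω.ncard + 2 * Nat.card ((openGraph ω ⊔ wired
            (discreteArc R.carrier δ (R.arc 0) ∪ discreteArc R.carrier δ (R.arc 2))).induce
            (meshDomain R.carrier δ)).ConnectedComponent))) t
    = ((∑ᶠ ω ∈ 𝒫 (discreteDomainGraph R.carrier δ).edgeSet,
          (discreteCrossing R.carrier δ (R.arc 0) (R.arc 2)).indicator
            (fun ω => ((ω.ncard + 2 * Nat.card ((openGraph ω ⊔ wired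
              (discreteArc R.carrier δ (R.arc 0) ∪ discreteArc R.carrier δ (R.arc 2))).induce
              (meshDomain R.carrier δ)).ConnectedComponent : ℕ) : ℂ)
              * t ^ (ω.ncard + 2 * Nat.card ((openGraph ω ⊔ wired
              (discreteArc R.carrier δ (R.arc 0) ∪ discreteArc R.carrier δ (R.arc 2))).induce
              (meshDomain R.carrier δ)).ConnectedComponent)) ω)
          * (∑ᶠ ω ∈ 𝒫 (discreteDomainGraph R.carrier δ).edgeSet,
              t ^ (ω.ncard + 2 * Nat.card ((openGraph ω ⊔ wired
                (discreteArc R.carrier δ (R.arc 0) ∪ discreteArc R.carrier δ (R.arc 2))).induce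
                (meshDomain R.carrier δ)).ConnectedComponent))
        - (∑ᶠ ω ∈ 𝒫 (discreteDomainGraph R.carrier δ).edgeSet,
            (discreteCrossing R.carrier δ (R.arc 0) (R.arc 2)).indicator
              (fun ω => t ^ (ω.ncard + 2 * Nat.card ((openGraph ω ⊔ wired
                (discreteArc R.carrier δ (R.arc 0) ∪ discreteArc R.carrier δ (R.arc 2))).induce
                (meshDomain R.carrier δ)).ConnectedComponent)) ω)
          * (∑ᶠ ω ∈ 𝒫 (discreteDomainGraph R.carrier δ).edgeSet,
              ((ω.ncard + 2 * Nat.card ((openGraph ω ⊔ wired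
                (discreteArc R.carrier δ (R.arc 0) ∪ discreteArc R.carrier δ (R.arc 2))).induce
                (meshDomain R.carrier δ)).ConnectedComponent : ℕ) : ℂ)
              * t ^ (ω.ncard + 2 * Nat.card ((openGraph ω ⊔ wired
                (discreteArc R.carrier δ (R.arc 0) ∪ discreteArc R.carrier δ (R.arc 2))).induce
                (meshDomain R.carrier δ)).ConnectedComponent))) /
      (t * (∑ᶠ ω ∈ 𝒫 (discreteDomainGraph R.carrier δ).edgeSet,
              t ^ (ω.ncard + 2 * Nat.card ((openGraph ω ⊔ wired
                (discreteArc R.carrier δ (R.arc 0) ∪ discreteArc R.carrier δ (R.arc 2))).induce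
                (meshDomain R.carrier δ)).ConnectedComponent)) ^ 2) := by
  have hfin := finite_powerset_edgeSet R.isBounded hδ
  simp only [finsum_mem_eq_finite_toFinset_sum _ hfin] at hZ ⊢
  exact (hasDerivAt_ratio hfin.toFinset _ _ ht hZ).deriv

/-- A nonempty finite sum of positive real powers, cast to `ℂ`, is nonzero. [folklore] -/
theorem sum_ofReal_pow_ne_zero {α : Type*} {F : Finset α} (hF : F.Nonempty) (m : α → ℕ) {r : ℝ}
    (hr : 0 < r) : (∑ a ∈ F, (r : ℂ) ^ m a) ≠ 0 := by
  have h : (∑ a ∈ F, (r : ℂ) ^ m a) = ((∑ a ∈ F, r ^ m a : ℝ) : ℂ) := by push_cast; rfl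
  rw [h, Complex.ofReal_ne_zero]
  exact (Finset.sum_pos (fun a _ => pow_pos hr (m a)) hF).ne'

/-- `Z_δ(√2) ≠ 0`: at the FK-Ising point every configuration has positive weight `√2^{L(ω)}` and the
empty configuration is one of them. [folklore] -/
theorem finsum_weight_sqrt_two_ne_zero (R : ConformalRectangle) {δ : ℝ} (hδ : 0 < δ) :
    (∑ᶠ ω ∈ 𝒫 (discreteDomainGraph R.carrier δ).edgeSet,
        (Real.sqrt 2 : ℂ) ^ (ω.ncard + 2 * Nat.card ((openGraph ω ⊔ wired
            (discreteArc R.carrier δ (R.arc 0) ∪ discreteArc R.carrier δ (R.arc 2))).induce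
            (meshDomain R.carrier δ)).ConnectedComponent)) ≠ 0 := by
  have hfin := finite_powerset_edgeSet R.isBounded hδ
  rw [finsum_mem_eq_finite_toFinset_sum _ hfin]
  exact sum_ofReal_pow_ne_zero ⟨∅, by simp⟩ _ (Real.sqrt_pos.2 two_pos)

/-- **The first Ising jet is an FK-Ising covariance**: at `t = √2` (critical FK-Ising, `q = 2`,
`p = √2/(1+√2)`, arcs jointly wired) the route's `P′_δ(√2)` — the quantity of crux `FirstJetConverges`
(stmt-CriticalPhenomena-5561) and the `n = 1` face of the higher-jet stub of crux `IsingJetsConformal`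
(stmt-CriticalPhenomena-5560) — equals `(Σ_ω 𝟙_C L √2^L · Z_δ − N_δ · Σ_ω L √2^L) / (√2 Z_δ²)`
`= Cov_{FK-Ising}(1_C, |ω| + 2k_B) / √2`, for every `δ > 0`, with no side condition. [cite: Grimmett2006, Thm 3.12] -/
theorem deriv_crossingRatio_sqrt_two (R : ConformalRectangle) {δ : ℝ} (hδ : 0 < δ) :
    deriv (fun s : ℂ =>
      (∑ᶠ ω ∈ 𝒫 (discreteDomainGraph R.carrier δ).edgeSet,
        (discreteCrossing R.carrier δ (R.arc 0) (R.arc 2)).indicator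
          (fun ω => s ^ (ω.ncard + 2 * Nat.card ((openGraph ω ⊔ wired
            (discreteArc R.carrier δ (R.arc 0) ∪ discreteArc R.carrier δ (R.arc 2))).induce
            (meshDomain R.carrier δ)).ConnectedComponent)) ω) /
      (∑ᶠ ω ∈ 𝒫 (discreteDomainGraph R.carrier δ).edgeSet,
        s ^ (ω.ncard + 2 * Nat.card ((openGraph ω ⊔ wired
            (discreteArc R.carrier δ (R.arc 0) ∪ discreteArc R.carrier δ (R.arc 2))).induce
            (meshDomain R.carrier δ)).ConnectedComponent))) (Real.sqrt 2 : ℂ)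
    = ((∑ᶠ ω ∈ 𝒫 (discreteDomainGraph R.carrier δ).edgeSet,
          (discreteCrossing R.carrier δ (R.arc 0) (R.arc 2)).indicator
            (fun ω => ((ω.ncard + 2 * Nat.card ((openGraph ω ⊔ wired
              (discreteArc R.carrier δ (R.arc 0) ∪ discreteArc R.carrier δ (R.arc 2))).induce
              (meshDomain R.carrier δ)).ConnectedComponent : ℕ) : ℂ)
              * (Real.sqrt 2 : ℂ) ^ (ω.ncard + 2 * Nat.card ((openGraph ω ⊔ wired
              (discreteArc R.carrier δ (R.arc 0) ∪ discreteArc R.carrier δ (R.arc 2))).induce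
              (meshDomain R.carrier δ)).ConnectedComponent)) ω)
          * (∑ᶠ ω ∈ 𝒫 (discreteDomainGraph R.carrier δ).edgeSet,
              (Real.sqrt 2 : ℂ) ^ (ω.ncard + 2 * Nat.card ((openGraph ω ⊔ wired
                (discreteArc R.carrier δ (R.arc 0) ∪ discreteArc R.carrier δ (R.arc 2))).induce
                (meshDomain R.carrier δ)).ConnectedComponent))
        - (∑ᶠ ω ∈ 𝒫 (discreteDomainGraph R.carrier δ).edgeSet,
            (discreteCrossing R.carrier δ (R.arc 0) (R.arc 2)).indicator
              (fun ω => (Real.sqrt 2 : ℂ) ^ (ω.ncard + 2 * Nat.card ((openGraph ω ⊔ wired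
                (discreteArc R.carrier δ (R.arc 0) ∪ discreteArc R.carrier δ (R.arc 2))).induce
                (meshDomain R.carrier δ)).ConnectedComponent)) ω)
          * (∑ᶠ ω ∈ 𝒫 (discreteDomainGraph R.carrier δ).edgeSet,
              ((ω.ncard + 2 * Nat.card ((openGraph ω ⊔ wired
                (discreteArc R.carrier δ (R.arc 0) ∪ discreteArc R.carrier δ (R.arc 2))).induce
                (meshDomain R.carrier δ)).ConnectedComponent : ℕ) : ℂ)
              * (Real.sqrt 2 : ℂ) ^ (ω.ncard + 2 * Nat.card ((openGraph ω ⊔ wired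
                (discreteArc R.carrier δ (R.arc 0) ∪ discreteArc R.carrier δ (R.arc 2))).induce
                (meshDomain R.carrier δ)).ConnectedComponent))) /
      ((Real.sqrt 2 : ℂ) * (∑ᶠ ω ∈ 𝒫 (discreteDomainGraph R.carrier δ).edgeSet,
              (Real.sqrt 2 : ℂ) ^ (ω.ncard + 2 * Nat.card ((openGraph ω ⊔ wired
                (discreteArc R.carrier δ (R.arc 0) ∪ discreteArc R.carrier δ (R.arc 2))).induce
                (meshDomain R.carrier δ)).ConnectedComponent)) ^ 2) := by
  have h2 : (Real.sqrt 2 : ℂ) ≠ 0 := by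
    exact_mod_cast (Real.sqrt_pos.2 two_pos).ne'
  exact deriv_crossingRatio R hδ h2 (finsum_weight_sqrt_two_ne_zero R hδ)

end

end Summit.CriticalPhenomena.CardyFormulaZ2.Theorems.CardyQContinuation
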